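import Mathlib
import HarnessLib
import Summits.ValiantsHypothesis.ValiantsHypothesis.Theorems.MonotoneRestorationOrbitRestorationQPHomPolyClose
import Summits.ValiantsHypothesis.ValiantsHypothesis.Theorems.MonotoneRestorationOrbitRestorationQPCloseOrbit

/-!
# Route MonotoneRestoration — aside `OrbitRestorationLinearVolumeQP` (stmt-ValiantsHypothesis-18294),
# line `birth` (skeleton `0500973389fe`): the two folklore stubs K2 `stub_homPoly_close` and K3 `stub_close_orbit`

The registered skeleton of the linear-volume re-target R1 composes
`stub_lvNarrowSpan → stub_homPoly_close → stub_close_orbit → OrbitRestorationLinearVolumeQP`, the last two being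
the parent crux's folklore bridges K2 (`HomPolyClose`: bounded treewidth ⇒ narrow labelled expression) and K3
(`CloseOrbit`: length-free orbit bound for closed expressions), registered BY NAME over the skeleton's local
vocabulary.  Both are theorems of the tree (`OrbitRestorationQPHomPolyClose.stub_homPoly_close`,
`Theorems.stub_close_orbit`, landed for stmt-ValiantsHypothesis-18293); this file spells the two statements out
verbatim under the skeleton's names and discharges the two stubs by name.  VP ≠ VNP is not moved; R1 rests on
`stub_lvNarrowSpan` alone (`OrbitRestorationLinearVolumeQPNarrow.orbitRestorationLinearVolumeQP_of_lvNarrowSpan`).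
-/

noncomputable section

-- `Summit.ValiantsHypothesis.ValiantsHypothesis.…` is the tree's single-conjunct layout (Sub = Summit).
set_option linter.dupNamespace false

namespace Summit.ValiantsHypothesis.ValiantsHypothesis.Theorems.OrbitRestorationLinearVolumeQPBirth

open Literature.Computability.AlgebraicComplexity

/-- **K2 `HomPolyClose`** (skeleton vocabulary of line `birth`, verbatim the parent crux's registered stub
`stub_homPoly_close` of `Cruxes/OrbitRestorationQP/Lines/narrow_expansion.lean`): a bipartite multigraph pattern of
treewidth `≤ w` is, for `n ≥ 1` and all label budgets `k, l ≥ w + 1`, the closed polynomial of a labelled pattern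
expression over `ℂ` with `k` row and `l` column labels.  (Line vocabulary, discharged below by
`stub_homPoly_close`; not a literature citation.) -/
def HomPolyClose : Prop :=
  ∀ (a b w : ℕ) (E : Multiset (Fin a × Fin b)),
    Literature.Combinatorics.SimpleGraph.treewidth
        (SimpleGraph.fromRel fun u v : Fin a ⊕ Fin b =>
          ∃ e ∈ E, u = Sum.inl e.1 ∧ v = Sum.inr e.2) ≤ w →
    ∀ n : ℕ, 1 ≤ n → ∀ k l : ℕ, w + 1 ≤ k → w + 1 ≤ l →
      ∃ e : PatternExpr ℂ k l, e.close n = homPoly E n ℂ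

/-- **K3 `CloseOrbit`** (skeleton vocabulary of line `birth`, verbatim the parent crux's registered stub
`stub_close_orbit`): for every `n` and every labelled pattern expression `e` with `k` row and `l` column labels
over `ℂ`, the closed polynomial `e.close n` is computed by a square-symmetric labelled circuit all of whose gate
orbits have size `≤ (n+1)^(k+l+2)`, whatever the length of `e`.  (Line vocabulary, discharged below by
`stub_close_orbit`; not a literature citation.) -/
def CloseOrbit : Prop :=
  ∀ (n k l : ℕ) (e : PatternExpr ℂ k l),
    ∃ (G : Type) (_ : Fintype G) (C : LabelledArithCircuit ℂ (Fin n × Fin n) Unit G),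
      C.IsSymmetric (Equiv.Perm (Fin n)) ∧ C.eval (C.output ()) = e.close n ∧
        C.orbitSize (Equiv.Perm (Fin n)) ≤ (n + 1) ^ (k + l + 2)

/-- **Stub `stub_homPoly_close` of line `birth` (aside `OrbitRestorationLinearVolumeQP`,
stmt-ValiantsHypothesis-18294), by name**: K2 holds — it is the tree theorem
`OrbitRestorationQPHomPolyClose.stub_homPoly_close` (rooted tree decomposition, bag labelling, junction-tree
contraction). [folklore] -/
theorem stub_homPoly_close : HomPolyClose :=
  OrbitRestorationQPHomPolyClose.stub_homPoly_close

/-- **Stub `stub_close_orbit` of line `birth` (aside `OrbitRestorationLinearVolumeQP`,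
stmt-ValiantsHypothesis-18294), by name**: K3 holds — it is the tree theorem `Theorems.stub_close_orbit`
(reduced term circuit of the normal unfoldings; orbits indexed by label assignments). [folklore] -/
theorem stub_close_orbit : CloseOrbit :=
  Theorems.stub_close_orbit

end Summit.ValiantsHypothesis.ValiantsHypothesis.Theorems.OrbitRestorationLinearVolumeQPBirth

end
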